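import Summits.QuantumFields.BalabanUV.T4Continuum.Spine.NE4.ScaleShiftFrozenHistory
import Summits.QuantumFields.BalabanUV.T4Continuum.Spine.NE4.AutonomousSchemeStable

/-!
# Spine/NE4/ScaleShiftFrozenOrbit — (R63) on the autonomous road of (R42): GIVEN the memory companion, NE4 asks of the
# k-independent step only STABILITY in the state (a Lipschitz constant of ANY size) and the geometric settling of the FROZEN
# (free) orbit of the bare state — no contraction, no margin, no spectral datum (cell `pub-balaban-gaps`, seat ne4, generation 20;
# census item (R63) of `HOME/ne/NE4.md` §5; β-level half = `Spine/NE4/ScaleShiftFrozenHistory.lean`)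

HONEST FRAMING.  Bookkeeping for rung (B)+1 on ONE FIXED finite four-torus — NOT ℝ⁴, NOT infinite volume, NOT a mass gap, NOT
Clay.  NE4 = `T4CouplingMatching.ScaleShiftRate` is NOT PRINTED ([Balaban1987RG1] p. 264) and NOT PROVED here; spine estimates proved
0∕9, unchanged.  Every hypothesis on the abstract scheme `A` (which space and which map realise Bałaban's RT is NOT decided here) and on
`β` is an UNPRINTED input; nothing of Bałaban's is instantiated or asserted.  0 sorry.

WHAT (vocabulary of `Spine/NE4/AutonomousScheme[Stable].lean`: `Markov.state`, `RepresentsAut`, `Invariant`, `StateContraction`,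
`FirstStep`, `ReadLipschitzOn`, `iter`, `OrbitStability`).  For a β-family read off the states of a k-independent step `A g` from the
bare state `ξ` ([Balaban1988Convergent] p. 262 «successive applications of the operations RT to the density ρ₀»), the frozen-prefix
bound `FrozenShift (fun k m ↦ cr·D·Λ^{k+1−m}·θ₀^m) γ β` of the β-level file — gain `θ₀` per frozen step, loss `Λ` per live step —
follows (`frozenShift_of_stable`) from
(i) `StateContraction A S Λ γ` with ANY `Λ ≥ 0`: for `Λ ≥ 1` this is mere Lipschitz STABILITY of the step in the state, NO contraction;
(ii) `FrozenOrbit A ξ D θ₀ γ`: for every depth `m` the orbit of the bare state under the step FROZEN at some bare coupling `ε ∈ ]0,γ]`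
of one's choosing is geometrically Cauchy, `dist ((A ε)^{m+1} ξ) ((A ε)^m ξ) ≤ D·θ₀^m + η` — obtained from the settling of the FREE orbit
(`A 0`, `FreeOrbit`) and continuity at `0⁺` (`FreeLimit`) by `frozenOrbit_of_free`, and implied by (R42)'s contraction
(`frozenOrbit_of_stateContraction`);
(iii) a Lipschitz read-out on the invariant set.
After the frozen prefix the two runs of NE4's comparison sit at CONSECUTIVE points of the frozen orbit (`D·θ₀^m` apart) and then apply
the SAME `k+1−m` live steps, which amplify by at most `Λ^{k+1−m}` (`Markov.orbitStability_of_stateContraction` at «rate» `Λ`).  With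
node U2's memory companion GIVEN (rate `ω < 1`; WITHOUT contraction the scheme does not supply it — it is an independent input here,
as on the print-faithful road), `exists_scaleShiftRate_of_stable_frozen`: NE4 at some rate `θ′ < 1`, for EVERY finite `Λ`.

A WITNESS (§4) that the new hypotheses are STRICTLY weaker for a given representation: the scheme `acc2 g (x, z) = (x∕2 + g, z + g)` on `ℝ × ℝ`
(sup metric) read through `Prod.fst` — a contracting visible coordinate and a NEUTRAL accumulator fed by the couplings that β never sees —
represents the β-family `accβ` (= the orbit of `x ↦ x∕2 + g`), is `1`-Lipschitz in the state (`acc2_stable`), has a motionless free orbit and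
frozen orbits tending to it (`acc2_frozenOrbit`), and `accβ` has the memory companion at rate `1∕2` (`accβ_memory`, from (R42) applied to the
visible coordinate ALONE) — so `exists_scaleShiftRate_of_stable_frozen` applies (`accβ_scaleShiftRate`); yet (R42)'s one-step contraction
FAILS on every invariant set containing the reachable states (`one_le_of_stateContraction_acc2`: two reachable states with equal visible
coordinate keep their accumulator gap `γ∕4`), and so does (R42)(e)'s cocycle form `OrbitStability` (`one_le_of_orbitStability_acc2`).  HONEST:
`Markov.near_canonical`'s caveat stands — the SAME β-family has other, contracting representations (drop the accumulator); the witness is about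
the hypotheses one must verify for a GIVEN state space (for Bałaban's RT: the space of activities with its inductive description; whether it
carries coupling-fed directions that the read-out (1.20)–(1.22) of [Balaban1987RG1] does not see — after the field-independent constants are
subtracted scale by scale in (1.3) — is NOT claimed here either way).

WHAT THIS SAYS FOR THE ROW (census (R63); evidence, no status word moves).  The idea road's hypotheses — contraction (R42), spectral
radius (R45), analyticity + linearisation (R46), the margin (R53) — are SUFFICIENT for NE4 and also deliver the memory companion; for
NE4 ITSELF, once the companion is granted, they are NOT NECESSARY: {stability with any constant, settling of the free orbit, Lipschitz
read-out} suffice.  READING (heuristic, labelled): the free orbit = the Gaussian data of the bare Wilson action at depth `m`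
(covariances ∕ propagators; rate `L^{−2m}`, rows NE2∕NE3); stability = the Cauchy-estimate currency of [Balaban1988RG2Cluster]'s
analyticity in the input activities (census (R1)), an η-UNIFORM statement.  HONEST CAVEAT: the memory companion is itself a
contraction-type statement in the COUPLING directions; what this file removes is the demand for contraction in the remaining
(state) directions, not the companion.

No status word moves: NE4 DEPENDENT (⇐ NE5 ∧ (AF-0r)); NOT IN PRINT; NOT PROVED; 0∕9.  HONEST DEPENDENCY (cell, verbatim): continuum
YM on T⁴ ⇐ BetaPertH ∧ nine spine estimates (0∕9 proved); BetaPertH ⇐ (D1) ∧ (D4) ∧ CAP+tail.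

References (TYPES only): [Balaban1987RG1] = T. Bałaban, Commun. Math. Phys. **109** (1987) 249–301, p. 264, §5 p. 298;
[Balaban1988Convergent] = CMP **119** (1988) 243–285, Thm 1 p. 262; [Balaban1988RG2Cluster] = CMP **116** (1988) 1–22, Lemma 3 (2.38)
p. 20.
-/

noncomputable section

open Filter Topology

namespace Summit.QuantumFields.BalabanUV.T4Continuum.Spine.NE4.ScaleShiftFrozenOrbit

open Literature.MathematicalPhysics.QuantumFieldTheory.Balaban1983to89
open Literature.MathematicalPhysics.QuantumFieldTheory.Balaban1983to89.FlowStep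
open T4CouplingMatching (ScaleShiftRate HistLipschitz FadingMemory)
open T4FlagMemory (extd extd_coe extd_adm extd_tail tail_mem_box Adm)
open Summit.QuantumFields.BalabanUV.T4Continuum.Spine.NE4.ScaleShiftFrozenHistory

/-! ## §1 Shapes: the frozen orbit settles; §2 the frozen-prefix bound from stability; §3 end to end -/

section Markov

open Summit.QuantumFields.BalabanUV.T4Continuum.Spine.NE4.Markov

variable {X : Type*} [PseudoMetricSpace X] {A : ℝ → X → X} {S : Set X} {ξ : X} {r : X → ℝ} {β : HBeta}
  {γ Λ D θ₀ cr : ℝ}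

/-- [shape] HYPOTHESIS SHAPE (NOT PRINTED): **THE FROZEN ORBIT SETTLES** — for every depth `m` and tolerance `η > 0` there is a bare coupling
`ε ∈ ]0,γ]` of one's choosing (e.g. only `ε → 0⁺`) such that the orbit of the bare state under the step FROZEN at `ε` is geometrically
Cauchy at depth `m`: `dist ((A ε)^{m+1} ξ) ((A ε)^m ξ) ≤ D·θ₀^m + η`.  At `ε → 0⁺` this is the settling of the FREE (Gaussian) flow of the
bare action (rows NE2∕NE3's kind of statement); NOT a fact. [folklore] -/
def FrozenOrbit (A : ℝ → X → X) (ξ : X) (D θ₀ γ : ℝ) : Prop :=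
  ∀ m : ℕ, ∀ η : ℝ, 0 < η → ∃ ε : ℝ, 0 < ε ∧ ε ≤ γ ∧
    dist (state A ξ (fun _ => ε) (m + 1)) (state A ξ (fun _ => ε) m) ≤ D * θ₀ ^ m + η

/-- [shape] HYPOTHESIS SHAPE (NOT PRINTED): **THE FREE ORBIT SETTLES GEOMETRICALLY** — the orbit of the bare state under the step at
coupling `0` is geometrically Cauchy: `dist ((A 0)^{m+1} ξ) ((A 0)^m ξ) ≤ D·θ₀^m`.  NOT a fact. [folklore] -/
def FreeOrbit (A : ℝ → X → X) (ξ : X) (D θ₀ : ℝ) : Prop :=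
  ∀ m : ℕ, dist (state A ξ (fun _ => (0 : ℝ)) (m + 1)) (state A ξ (fun _ => (0 : ℝ)) m) ≤ D * θ₀ ^ m

/-- [shape] HYPOTHESIS SHAPE: **CONTINUITY OF THE FROZEN ORBIT AT VANISHING COUPLING** — at every depth, the frozen orbit at `ε` tends to
the free orbit as `ε → 0⁺` (printed qualitative form for the read-out: [Balaban1987RG1] p. 264, β smooth on the CLOSED interval `[0,γ]`).
NOT a fact. [cite: Balaban1987RG1, §1 p.264] -/
def FreeLimit (A : ℝ → X → X) (ξ : X) : Prop :=
  ∀ m : ℕ, Tendsto (fun ε : ℝ => state A ξ (fun _ => ε) m) (𝓝[>] 0) (𝓝 (state A ξ (fun _ => (0 : ℝ)) m))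

/-- **FROZEN FROM FREE**: the settling of the free orbit + continuity at `0⁺` ⇒ `FrozenOrbit A ξ D θ₀ γ` (`γ > 0`), with `ε` as small as
one pleases. [folklore] -/
theorem frozenOrbit_of_free (hγ : 0 < γ) (hfree : FreeOrbit A ξ D θ₀) (hlim : FreeLimit A ξ) :
    FrozenOrbit A ξ D θ₀ γ := by
  intro m η hη
  have hd : Tendsto (fun ε : ℝ => dist (state A ξ (fun _ => ε) (m + 1)) (state A ξ (fun _ => ε) m))
      (𝓝[>] 0) (𝓝 (dist (state A ξ (fun _ => (0 : ℝ)) (m + 1)) (state A ξ (fun _ => (0 : ℝ)) m))) :=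
    (hlim (m + 1)).dist (hlim m)
  have hlt : dist (state A ξ (fun _ => (0 : ℝ)) (m + 1)) (state A ξ (fun _ => (0 : ℝ)) m) < D * θ₀ ^ m + η :=
    lt_of_le_of_lt (hfree m) (lt_add_of_pos_right _ hη)
  have h1 : ∀ᶠ ε : ℝ in 𝓝[>] 0,
      dist (state A ξ (fun _ => ε) (m + 1)) (state A ξ (fun _ => ε) m) < D * θ₀ ^ m + η :=
    hd.eventually (gt_mem_nhds hlt)
  have h2 : ∀ᶠ ε : ℝ in 𝓝[>] 0, 0 < ε := self_mem_nhdsWithin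
  have h3 : ∀ᶠ ε : ℝ in 𝓝[>] 0, ε ≤ γ := mem_nhdsWithin_of_mem_nhds (Iic_mem_nhds hγ)
  obtain ⟨ε, ⟨hε1, hε2⟩, hε3⟩ := ((h1.and h2).and h3).exists
  exact ⟨ε, hε2, hε3, hε1.le⟩

/-- **FROZEN FROM CONTRACTION** (sanity: (R42)'s hypotheses imply this file's): under `Invariant A S γ ∋ ξ`, `StateContraction A S θ γ`
(`θ ≥ 0`) and `FirstStep A ξ D γ`, every frozen orbit settles at rate `θ`: `FrozenOrbit A ξ D θ γ` (any `ε`, e.g. `ε = γ`;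
`Markov.dist_state_shift_le` along the constant sequence). [folklore] -/
theorem frozenOrbit_of_stateContraction {θ : ℝ} (hγ : 0 < γ) (hθ : 0 ≤ θ) (hInv : Invariant A S γ) (hξ : ξ ∈ S)
    (hcon : StateContraction A S θ γ) (hfirst : FirstStep A ξ D γ) : FrozenOrbit A ξ D θ γ := by
  intro m η hη
  refine ⟨γ, hγ, le_rfl, ?_⟩
  have hadm : Adm γ (fun _ : ℕ => γ) := fun _ => ⟨hγ, le_rfl⟩
  have h := dist_state_shift_le hθ hInv hξ hcon hfirst hadm m
  exact h.trans (le_add_of_nonneg_right hη.le)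

omit [PseudoMetricSpace X] in
/-- [bookkeeping] the composite of steps `i+1, …` along `g` is the composite of steps `i, …` along the shifted sequence. [folklore] -/
theorem iter_succ_index (A : ℝ → X → X) (g : ℕ → ℝ) (i : ℕ) :
    ∀ n x, iter A g (i + 1) n x = iter A (fun j => g (j + 1)) i n x
  | 0, _ => rfl
  | n + 1, x => by
    rw [iter_succ, iter_succ, iter_succ_index A g i n x, Nat.add_right_comm]

omit [PseudoMetricSpace X] in
/-- [bookkeeping] along the extension of a history frozen at `ε` on its first `m` entries (`m ≤ n+1`), the state after `m` steps is the
frozen orbit's. [folklore] -/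
theorem state_extd_frz {n m : ℕ} (ε : ℝ) (w : Fin (n + 1) → ℝ) (hm : m ≤ n + 1) :
    state A ξ (extd (frz m ε w)) m = state A ξ (fun _ => ε) m :=
  state_congr m fun _ hj => extd_frz_of_lt ε w hj hm

/-- **STABILITY + FROZEN-ORBIT SETTLING ⇒ THE FROZEN-PREFIX BOUND.**  For a β-family represented by the autonomous scheme
(`RepresentsAut A r ξ γ β`, `ReadLipschitzOn r S cr`, `Invariant A S γ ∋ ξ`): if each step is `Λ`-LIPSCHITZ in the state on `S`
(`StateContraction A S Λ γ` with ANY `Λ ≥ 0` — for `Λ ≥ 1` no contraction at all) and `FrozenOrbit A ξ D θ₀ γ`, then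
`FrozenShift (fun k m ↦ cr·D·Λ^{k+1−m}·θ₀^m) γ β`: after the frozen prefix the two runs sit at consecutive points of the frozen orbit
(`D·θ₀^m` apart), and the `k+1−m` common live steps amplify that by at most `Λ^{k+1−m}`.  HYPOTHESES ONLY about the scheme. [folklore] -/
theorem frozenShift_of_stable (hInv : Invariant A S γ) (hξ : ξ ∈ S) (hΛ0 : 0 ≤ Λ)
    (hstab : StateContraction A S Λ γ) (horb : FrozenOrbit A ξ D θ₀ γ)
    (hrep : RepresentsAut A r ξ γ β) (hr : ReadLipschitzOn r S cr) (hcr : 0 ≤ cr) :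
    FrozenShift (fun k m => cr * D * Λ ^ (k + 1 - m) * θ₀ ^ m) γ β := by
  intro k m hm w hw η hη
  set K := cr * Λ ^ (k + 1 - m) with hK
  have hK0 : 0 ≤ K := by positivity
  obtain ⟨ε, hε0, hεγ, hεd⟩ := horb m (η / (K + 1)) (by positivity)
  refine ⟨ε, hε0, hεγ, ?_⟩
  have hwB : frz (m + 1) ε w ∈ Box γ (k + 1) := frz_mem_box hε0 hεγ hw
  have hwA : frz m ε (Fin.tail w) ∈ Box γ k := frz_mem_box hε0 hεγ (tail_mem_box hw)
  rw [hrep (k + 1) _ hwB, hrep k _ hwA]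
  set gB : ℕ → ℝ := extd (frz (m + 1) ε w) with hgB
  have hgA : extd (frz m ε (Fin.tail w)) = fun j => gB (j + 1) := by
    rw [← tail_frz]; exact extd_tail _
  rw [hgA]
  have hadmB : Adm γ gB := extd_adm hwB
  have hadmA : Adm γ (fun j => gB (j + 1)) := adm_shift hadmB
  -- decompose both states: frozen prefix, then the common live composite
  set n := k + 1 - m with hn
  have eB : state A ξ gB (k + 1 + 1) = iter A gB (m + 1) n (state A ξ gB (m + 1)) := by
    have h := state_eq_iter A ξ gB (m + 1) n
    rwa [show m + 1 + n = k + 1 + 1 by omega] at h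
  have eA : state A ξ (fun j => gB (j + 1)) (k + 1)
      = iter A (fun j => gB (j + 1)) m n (state A ξ (fun j => gB (j + 1)) m) := by
    have h := state_eq_iter A ξ (fun j => gB (j + 1)) m n
    rwa [show m + n = k + 1 by omega] at h
  have pB : state A ξ gB (m + 1) = state A ξ (fun _ => ε) (m + 1) := state_extd_frz ε w (by omega)
  have pA : state A ξ (fun j => gB (j + 1)) m = state A ξ (fun _ => ε) m := by
    rw [← hgA]; exact state_extd_frz ε (Fin.tail w) hm
  have eI : ∀ x, iter A gB (m + 1) n x = iter A (fun j => gB (j + 1)) m n x := iter_succ_index A gB m n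
  rw [eB, eA, eI, pB, pA]
  -- membership of the two prefix states
  have hadmε : Adm γ (fun _ : ℕ => ε) := fun _ => ⟨hε0, hεγ⟩
  have hxB : state A ξ (fun _ => ε) (m + 1) ∈ S := state_mem hInv hξ hadmε _
  have hxA : state A ξ (fun _ => ε) m ∈ S := state_mem hInv hξ hadmε _
  have hst := orbitStability_of_stateContraction hΛ0 hInv hstab
  have hiter := hst _ hadmA m n _ hxB _ hxA
  have hyB := iter_mem hInv hadmA m n _ hxB
  have hyA := iter_mem hInv hadmA m n _ hxA
  calc |r (iter A (fun j => gB (j + 1)) m n (state A ξ (fun _ => ε) (m + 1)))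
        - r (iter A (fun j => gB (j + 1)) m n (state A ξ (fun _ => ε) m))|
      ≤ cr * dist (iter A (fun j => gB (j + 1)) m n (state A ξ (fun _ => ε) (m + 1)))
          (iter A (fun j => gB (j + 1)) m n (state A ξ (fun _ => ε) m)) := hr _ hyB _ hyA
    _ ≤ cr * (1 * Λ ^ n * dist (state A ξ (fun _ => ε) (m + 1)) (state A ξ (fun _ => ε) m)) :=
        mul_le_mul_of_nonneg_left hiter hcr
    _ ≤ cr * (1 * Λ ^ n * (D * θ₀ ^ m + η / (K + 1))) :=
        mul_le_mul_of_nonneg_left (mul_le_mul_of_nonneg_left hεd (by positivity)) hcr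
    _ = cr * D * Λ ^ n * θ₀ ^ m + K * (η / (K + 1)) := by rw [hK]; ring
    _ ≤ cr * D * Λ ^ n * θ₀ ^ m + η := by
        have : K * (η / (K + 1)) ≤ η := by
          rw [mul_div_assoc']
          rw [div_le_iff₀ (by positivity)]
          nlinarith
        linarith

/-- **END TO END ON THE AUTONOMOUS ROAD, WITHOUT CONTRACTION.**  A β-family represented by a scheme whose steps are Lipschitz in the state
with ANY uniform constant `Λ ≥ 0`, whose frozen (free) orbit settles geometrically (`θ₀ < 1`), read by a Lipschitz read-out — AND which
has node U2's memory companion with some rate `ω < 1` (an INDEPENDENT input here: without contraction the scheme does not supply it) —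
satisfies NE4 at some rate `θ′ < 1`: `∃ c′ θ′, θ′ < 1 ∧ ScaleShiftRate c′ θ′ γ β`.  Contrast `Markov.ne4_of_markov` ((R42): contraction
`θ < 1` delivers NE4 AND the companion) and `AutonomousSchemeMargin` ((R53): a margin).  HYPOTHESES ONLY. [folklore] -/
theorem exists_scaleShiftRate_of_stable_frozen {Λm : ℕ → ℕ → ℝ} {C ω : ℝ}
    (hInv : Invariant A S γ) (hξ : ξ ∈ S) (hΛ0 : 0 ≤ Λ)
    (hstab : StateContraction A S Λ γ) (horb : FrozenOrbit A ξ D θ₀ γ)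
    (hrep : RepresentsAut A r ξ γ β) (hr : ReadLipschitzOn r S cr) (hcr : 0 ≤ cr) (hD : 0 ≤ D)
    (hθ0 : 0 ≤ θ₀) (hθ1 : θ₀ < 1)
    (hL : HistLipschitz Λm γ β) (hΛm : FadingMemory C ω Λm) (hC : 0 ≤ C) (hω0 : 0 ≤ ω) (hω1 : ω < 1) (hγ : 0 < γ) :
    ∃ c' θ' : ℝ, 0 ≤ c' ∧ 0 ≤ θ' ∧ θ' < 1 ∧ ScaleShiftRate c' θ' γ β :=
  exists_scaleShiftRate_of_frozenShift hL hΛm hC hω0 hω1 hγ (by positivity) hΛ0 hθ0 hθ1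
    (frozenShift_of_stable hInv hξ hΛ0 hstab horb hrep hr hcr)

end Markov

/-! ## §4 A witness: the new hypotheses hold where (R42)'s contraction fails for the SAME representation -/

section Witness

open Summit.QuantumFields.BalabanUV.T4Continuum.Spine.NE4.Markov

/-- The VISIBLE coordinate of the witness: `x ↦ x∕2 + g` (contracting, rate 1∕2). [folklore] -/
def acc1 : ℝ → ℝ → ℝ := fun g x => x / 2 + g

/-- The witness scheme on `ℝ × ℝ` (sup metric): a contracting visible coordinate `x ↦ x∕2 + g` and a NEUTRAL accumulator `z ↦ z + g`
that the read-out never sees — a caricature of a bookkeeping coordinate of the state that is fed by the couplings, never contracts, and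
does not enter β (nothing is claimed about whether Bałaban's state space has such directions). [folklore] -/
def acc2 : ℝ → ℝ × ℝ → ℝ × ℝ := fun g p => (p.1 / 2 + g, p.2 + g)

/-- The β-family of the witness: read off the visible coordinate. [folklore] -/
def accβ : HBeta := fun k v => state acc1 0 (extd v) (k + 1)

/-- [bookkeeping] the visible coordinate of the 2-d scheme evolves as the 1-d scheme. [folklore] -/
theorem acc2_fst (g : ℕ → ℝ) : ∀ j, (state acc2 ((0 : ℝ), (0 : ℝ)) g j).1 = state acc1 0 g j
  | 0 => rfl
  | j + 1 => by rw [state_succ, state_succ, ← acc2_fst g j]; rfl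

/-- The witness β-family IS represented by the 2-d scheme read through `Prod.fst`. [folklore] -/
theorem accβ_represents (γ : ℝ) : RepresentsAut acc2 Prod.fst ((0 : ℝ), (0 : ℝ)) γ accβ :=
  fun k v _ => (acc2_fst (extd v) (k + 1)).symm

/-- The 1-d scheme contracts at rate `1∕2` and is `1`-Lipschitz in the coupling; hence (by (R42)'s `histLipschitz_of_markov` ∕
`fadingMemory_of_markov` on `univ`) the witness HAS node U2's memory companion: `HistLipschitz Λ γ accβ ∧ FadingMemory 1 (1∕2) Λ` with
`Λ k i = (1∕2)^{k−i}`. [folklore] -/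
theorem accβ_memory (γ : ℝ) :
    HistLipschitz (fun k i => 1 * 1 * (1 / 2 : ℝ) ^ (k - i)) γ accβ ∧ FadingMemory (1 * 1) (1 / 2) (fun k i => 1 * 1 * (1 / 2 : ℝ) ^ (k - i)) := by
  have hInv : Invariant acc1 Set.univ γ := fun _ _ _ _ _ => Set.mem_univ _
  have hcon : StateContraction acc1 Set.univ (1 / 2) γ := by
    intro g _ _ x _ y _
    show |x / 2 + g - (y / 2 + g)| ≤ 1 / 2 * |x - y|
    rw [show x / 2 + g - (y / 2 + g) = (1 / 2) * (x - y) by ring, abs_mul, abs_of_pos (by norm_num : (0:ℝ) < 1 / 2)]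
  have hlip : StateCouplingLipschitz acc1 Set.univ 1 γ := by
    intro g g' _ _ _ _ x _
    show |x / 2 + g - (x / 2 + g')| ≤ 1 * |g - g'|
    rw [show x / 2 + g - (x / 2 + g') = g - g' by ring, one_mul]
  have hrep : RepresentsAut acc1 (fun x => x) 0 γ accβ := fun _ _ _ => rfl
  have hr : ReadLipschitzOn (fun x : ℝ => x) Set.univ 1 := fun x _ x' _ => by simp [Real.dist_eq]
  exact ⟨histLipschitz_of_markov (by norm_num) zero_le_one hInv (Set.mem_univ _) hcon hlip hrep hr,
    fadingMemory_of_markov (by norm_num) zero_le_one zero_le_one⟩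

/-- The 2-d scheme is `1`-LIPSCHITZ in the state on all of `ℝ × ℝ` (STABILITY, `Λ = 1`): `StateContraction acc2 univ 1 γ`. [folklore] -/
theorem acc2_stable (γ : ℝ) : StateContraction acc2 Set.univ 1 γ := by
  intro g _ _ p _ q _
  rw [one_mul, Prod.dist_eq, Prod.dist_eq]
  refine max_le ?_ ?_
  · show dist (p.1 / 2 + g) (q.1 / 2 + g) ≤ _
    rw [Real.dist_eq, show p.1 / 2 + g - (q.1 / 2 + g) = (1 / 2) * (p.1 - q.1) by ring, abs_mul,
      abs_of_pos (by norm_num : (0:ℝ) < 1 / 2)]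
    exact le_max_of_le_left (by rw [Real.dist_eq]; linarith [abs_nonneg (p.1 - q.1)])
  · show dist (p.2 + g) (q.2 + g) ≤ _
    rw [Real.dist_eq, show p.2 + g - (q.2 + g) = p.2 - q.2 by ring, ← Real.dist_eq]
    exact le_max_right _ _

/-- [bookkeeping] the frozen orbit of the witness is LINEAR in the frozen coupling: `state acc2 0 (const ε) m = ε • v_m`. [folklore] -/
theorem acc2_state_const : ∀ m : ℕ, ∃ v : ℝ × ℝ, ∀ ε : ℝ, state acc2 ((0 : ℝ), (0 : ℝ)) (fun _ => ε) m = ε • v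
  | 0 => ⟨0, fun ε => by simp⟩
  | m + 1 => by
    obtain ⟨v, hv⟩ := acc2_state_const m
    refine ⟨(v.1 / 2 + 1, v.2 + 1), fun ε => ?_⟩
    rw [state_succ, hv ε]
    refine Prod.ext ?_ ?_ <;> (simp [acc2]; ring)

/-- The FREE orbit of the witness does not move (`D = 0`) and the frozen orbits tend to it: `FrozenOrbit acc2 0 0 θ₀ γ` for every `θ₀`
and `γ > 0` (via `frozenOrbit_of_free`). [folklore] -/
theorem acc2_frozenOrbit {γ : ℝ} (hγ : 0 < γ) (θ₀ : ℝ) : FrozenOrbit acc2 ((0 : ℝ), (0 : ℝ)) 0 θ₀ γ := by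
  refine frozenOrbit_of_free hγ (fun m => ?_) (fun m => ?_)
  · obtain ⟨v, hv⟩ := acc2_state_const (m + 1)
    obtain ⟨v', hv'⟩ := acc2_state_const m
    rw [hv 0, hv' 0, zero_smul, zero_smul, dist_self, zero_mul]
  · obtain ⟨v, hv⟩ := acc2_state_const m
    have e : (fun ε : ℝ => state acc2 ((0 : ℝ), (0 : ℝ)) (fun _ => ε) m) = fun ε => ε • v := funext hv
    rw [e, hv 0]
    exact ((continuous_id.smul continuous_const).tendsto 0).mono_left nhdsWithin_le_nhds

/-- **ALL OF (R63)'s HYPOTHESES HOLD FOR THE WITNESS** (so `exists_scaleShiftRate_of_stable_frozen` applies to it): for `γ > 0` there are `c′, θ′ < 1`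
with `ScaleShiftRate c′ θ′ γ accβ`, obtained from stability `Λ = 1`, the frozen orbit, the read-out `Prod.fst` and the memory companion — NOT from
any contraction of `acc2`. [folklore] -/
theorem accβ_scaleShiftRate {γ : ℝ} (hγ : 0 < γ) : ∃ c' θ' : ℝ, 0 ≤ c' ∧ 0 ≤ θ' ∧ θ' < 1 ∧ ScaleShiftRate c' θ' γ accβ := by
  obtain ⟨hL, hΛ⟩ := accβ_memory γ
  have hInv : Invariant acc2 Set.univ γ := fun _ _ _ _ _ => Set.mem_univ _
  have hr : ReadLipschitzOn (Prod.fst : ℝ × ℝ → ℝ) Set.univ 1 := fun p _ q _ => by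
    rw [one_mul, Prod.dist_eq, ← Real.dist_eq]; exact le_max_left _ _
  exact exists_scaleShiftRate_of_stable_frozen (θ₀ := 1 / 2) hInv (Set.mem_univ _) zero_le_one (acc2_stable γ)
    (acc2_frozenOrbit hγ (1 / 2)) (accβ_represents γ) hr zero_le_one le_rfl (by norm_num) (by norm_num)
    hL hΛ (by norm_num) (by norm_num) (by norm_num) hγ

/-- Two REACHABLE states of the witness with the same visible coordinate and different accumulators: after the admissible histories
`(γ, γ∕4, γ, γ, …)` and `(γ∕2, γ∕2, γ, γ, …)` two steps give `x = 3γ∕4` both times and `z = 5γ∕4` resp. `γ`. [folklore] -/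
theorem acc2_reach_pair {γ : ℝ} (hγ : 0 < γ) :
    ((3 * γ / 4, 5 * γ / 4) : ℝ × ℝ) ∈ reach acc2 ((0 : ℝ), (0 : ℝ)) γ ∧ ((3 * γ / 4, γ) : ℝ × ℝ) ∈ reach acc2 ((0 : ℝ), (0 : ℝ)) γ := by
  set g1 : ℕ → ℝ := fun m => if m = 0 then γ else if m = 1 then γ / 4 else γ with hg1
  set g2 : ℕ → ℝ := fun m => if m = 0 then γ / 2 else if m = 1 then γ / 2 else γ with hg2
  have e10 : g1 0 = γ := by simp [hg1]
  have e11 : g1 1 = γ / 4 := by simp [hg1]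
  have e20 : g2 0 = γ / 2 := by simp [hg2]
  have e21 : g2 1 = γ / 2 := by simp [hg2]
  refine ⟨⟨g1, fun m => ?_, 2, ?_⟩, ⟨g2, fun m => ?_, 2, ?_⟩⟩
  · by_cases h0 : m = 0
    · rw [h0, e10]; exact ⟨hγ, le_rfl⟩
    · by_cases h1 : m = 1
      · rw [h1, e11]; constructor <;> linarith
      · have : g1 m = γ := by simp [hg1, h0, h1]
        rw [this]; exact ⟨hγ, le_rfl⟩
  · show acc2 (g1 1) (acc2 (g1 0) ((0 : ℝ), (0 : ℝ))) = _
    rw [e10, e11]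
    refine Prod.ext ?_ ?_ <;> (dsimp only [acc2]; ring)
  · by_cases h0 : m = 0
    · rw [h0, e20]; constructor <;> linarith
    · by_cases h1 : m = 1
      · rw [h1, e21]; constructor <;> linarith
      · have : g2 m = γ := by simp [hg2, h0, h1]
        rw [this]; exact ⟨hγ, le_rfl⟩
  · show acc2 (g2 1) (acc2 (g2 0) ((0 : ℝ), (0 : ℝ))) = _
    rw [e20, e21]
    refine Prod.ext ?_ ?_ <;> (dsimp only [acc2]; ring)

/-- **(R42)'s ONE-STEP CONTRACTION FAILS FOR THE WITNESS ON EVERY INVARIANT SET CONTAINING THE REACHABLE STATES**: if `reach acc2 0 γ ⊆ S` and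
`StateContraction acc2 S θ γ` then `1 ≤ θ` (`γ > 0`) — the accumulator gap `γ∕4` between the two reachable states of `acc2_reach_pair` is kept by every
step.  So for THIS representation NE4 follows from (R63)'s hypotheses (`accβ_scaleShiftRate`) and NOT from (R42)'s; (R42)'s `Markov.near_canonical` caveat
stands: the same β-family has OTHER, contracting representations (here: drop the accumulator). [folklore] -/
theorem one_le_of_stateContraction_acc2 {γ θ : ℝ} {S : Set (ℝ × ℝ)} (hγ : 0 < γ) (hS : reach acc2 ((0 : ℝ), (0 : ℝ)) γ ⊆ S)
    (hcon : StateContraction acc2 S θ γ) : 1 ≤ θ := by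
  obtain ⟨h1, h2⟩ := acc2_reach_pair hγ
  have h := hcon γ hγ le_rfl _ (hS h1) _ (hS h2)
  have hd : dist ((3 * γ / 4, 5 * γ / 4) : ℝ × ℝ) ((3 * γ / 4, γ) : ℝ × ℝ) = γ / 4 := by
    rw [Prod.dist_eq, Real.dist_eq, Real.dist_eq, sub_self, abs_zero,
      show 5 * γ / 4 - γ = γ / 4 by ring, abs_of_pos (by linarith), max_eq_right (by linarith)]
  have hd' : dist (acc2 γ ((3 * γ / 4, 5 * γ / 4) : ℝ × ℝ)) (acc2 γ ((3 * γ / 4, γ) : ℝ × ℝ)) = γ / 4 := by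
    simp only [acc2]
    rw [Prod.dist_eq, Real.dist_eq, Real.dist_eq, sub_self, abs_zero,
      show 5 * γ / 4 + γ - (γ + γ) = γ / 4 by ring, abs_of_pos (by linarith), max_eq_right (by linarith)]
  rw [hd, hd'] at h
  nlinarith

/-- … and (R42)(e)'s COCYCLE form fails too: `OrbitStability acc2 S C θ γ` with `reach ⊆ S` forces `θ ≥ 1` (the gap `γ∕4` survives every composite of
steps, while `C·θ^n → 0` if `θ < 1`). [folklore] -/
theorem one_le_of_orbitStability_acc2 {γ θ C : ℝ} {S : Set (ℝ × ℝ)} (hγ : 0 < γ) (hθ : 0 ≤ θ) (hS : reach acc2 ((0 : ℝ), (0 : ℝ)) γ ⊆ S)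
    (hst : OrbitStability acc2 S C θ γ) : 1 ≤ θ := by
  refine not_lt.mp fun hlt => ?_
  obtain ⟨h1, h2⟩ := acc2_reach_pair hγ
  have hadm : Adm γ (fun _ : ℕ => γ) := fun _ => ⟨hγ, le_rfl⟩
  -- the composites along the constant sequence keep the accumulator gap γ/4 and the visible coordinates equal
  have key : ∀ n, dist (iter acc2 (fun _ : ℕ => γ) 0 n ((3 * γ / 4, 5 * γ / 4) : ℝ × ℝ))
      (iter acc2 (fun _ : ℕ => γ) 0 n ((3 * γ / 4, γ) : ℝ × ℝ)) = γ / 4 := by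
    have inv : ∀ n, (iter acc2 (fun _ : ℕ => γ) 0 n ((3 * γ / 4, 5 * γ / 4) : ℝ × ℝ)).1
          = (iter acc2 (fun _ : ℕ => γ) 0 n ((3 * γ / 4, γ) : ℝ × ℝ)).1 ∧
        (iter acc2 (fun _ : ℕ => γ) 0 n ((3 * γ / 4, 5 * γ / 4) : ℝ × ℝ)).2
          = (iter acc2 (fun _ : ℕ => γ) 0 n ((3 * γ / 4, γ) : ℝ × ℝ)).2 + γ / 4 := by
      intro n
      induction n with
      | zero => simp; ring
      | succ n ih =>
        rw [iter_succ, iter_succ]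
        simp only [acc2]
        exact ⟨by rw [ih.1], by rw [ih.2]; ring⟩
    intro n
    rw [Prod.dist_eq, Real.dist_eq, Real.dist_eq, (inv n).1, sub_self, abs_zero, (inv n).2, add_sub_cancel_left,
      abs_of_pos (by linarith), max_eq_right (by linarith)]
  have hlim : Tendsto (fun n : ℕ => C * θ ^ n * (γ / 4)) atTop (𝓝 (C * 0 * (γ / 4))) :=
    ((tendsto_pow_atTop_nhds_zero_of_lt_one hθ hlt).const_mul C).mul_const _
  rw [mul_zero, zero_mul] at hlim
  have hev := hlim.eventually (gt_mem_nhds (show (0 : ℝ) < γ / 4 by linarith))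
  obtain ⟨n, hn⟩ := hev.exists
  have h := hst _ hadm 0 n _ (hS h1) _ (hS h2)
  have hd0 : dist ((3 * γ / 4, 5 * γ / 4) : ℝ × ℝ) ((3 * γ / 4, γ) : ℝ × ℝ) = γ / 4 := by simpa using key 0
  rw [key n, hd0] at h
  linarith

end Witness

end Summit.QuantumFields.BalabanUV.T4Continuum.Spine.NE4.ScaleShiftFrozenOrbit

end
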